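import Literature.Geometry.Riemannian.GurskyEinsteinGapSplit
import Literature.Geometry.Riemannian.GurskyEinsteinGapOfWeylGap
import HarnessLib

/-!
# Gursky's Einstein gap on homotopy `4`-spheres from THREE printed children
(topic `Geometry/Riemannian`; CHILD 4 of `GurskyEinsteinGapSplit.lean` — Chern–Gauss–Bonnet — removed)

`GurskyEinsteinGapSplit.lean` proves the named fact
`Literature.Geometry.Riemannian.gursky_einstein_homotopySphere_four` (Gursky 2000, Thm. 1 on `M ≃ₕ S⁴`)
from FOUR children read frame-wise along an orientation (`gursky_einstein_homotopySphere_four_holds_of`):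
(1) Gursky–LeBrun 1999 Thm. 1 (`W⁺ ≢ 0 ⟹ (2λ²/3) vol ≤ ∫ w₊`), (2) its mirror Cor. 1 for `w₋`, (3) the
signature formula with `τ = 0` (`∫ w₊ = ∫ w₋`) and (4) Chern–Gauss–Bonnet with `χ = 2`, `r̊ = 0`
(`∫ w₊ + ∫ w₋ + (2λ²/3) vol = 16π²`), where `w₊, w₋ : M → ℝ` are "versions" of `|W^±|²` — at each point
`¼‖A(e) − (tr A(e)/3)1‖²_F`, `¼‖C(e) − (tr C(e)/3)1‖²_F` in SOME positive orthonormal frame `e`.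

Child (4) is now superfluous. The general Chern–Gauss–Bonnet formula is a theorem of the tree
(`chernGaussBonnet_four_holds`), whence `∫|W|² dV + (8λ²/3) vol = 64π²` for Einstein metrics on homotopy
4-spheres (`weylEnergy_add_volume_eq_of_einstein_homotopySphere_four`, `GurskyEinsteinGapOfWeylGap.lean`);
pointwise `w₊ + w₋ = ¼ Σ W(e)² = ¼|W|²` in ANY orthonormal frame (`weylNormSqFrame_eq_hamiltonBlocks`,
`weylNormSq_eq_weylNormSqFrame_four`); and for the LOWER Lebesgue integrals of the (a priori not even
measurable) versions `w₊, w₋` one always has `∫⁻w₊ + ∫⁻w₋ ≤ ∫⁻(w₊ + w₋) = ¼∫|W|²` (`le_lintegral_add`).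
So `∫⁻w₊ + ∫⁻w₋ + (2λ²/3) vol ≤ 16π²` — and the printed argument (Gursky–LeBrun 1999, §5) only ever uses
child (4) as this upper bound: if `w₊ ≢ 0`, (1) and (3) give `3·(2λ²/3) vol ≤ ∫⁻w₊ + ∫⁻w₋ + (2λ²/3) vol ≤ 16π²`.

* `gursky_einstein_homotopySphere_four_of_oriented_three` — the oriented reduction with children (1)–(3);
* `gursky_einstein_homotopySphere_four_holds_of_three` — the fact from
  `GurskyLeBrun1999_thm1_homotopySphere`, `GurskyLeBrun1999_cor1_homotopySphere`,
  `signatureFormula_weyl_homotopySphere_four` (the named children of the Split file).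

No new definition, no new named fact. Consumers: route `SmoothPoincare4/EntropyRung`, crux `CompactShrinkerGap`
(stmt-SmoothPoincare4-10870), Einstein door (`Summit.….Theorems.helper_einsteinDoorReductionKillingHopf`).

## References

* M. J. Gursky, Math. Ann. 318 (2000) 417–431, Theorem 1. [Gursky2000]
* M. J. Gursky, C. LeBrun, Ann. Global Anal. Geom. 17 (1999) 315–328, §2 (gb)–(sig), §3 Thm. 1, Cor. 1, §5.
  [GurskyLebrun1999]
* A. L. Besse, Einstein Manifolds (1987), 6.31–6.34. [Besse1987]
-/

noncomputable section

open MeasureTheory Module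
open scoped Manifold ContDiff ENNReal ContinuousMap

namespace Literature.Geometry.Riemannian

open Literature.Geometry.Lorentzian (PseudoRiemannianMetric riemannianMeasure)
open Literature.Geometry.Lorentzian.PseudoRiemannianMetric
open Literature.Topology.FourManifolds (SmoothOrientation IsOrientable
  isOrientable_of_simplyConnectedSpace_holds)

/-- A single squared frame component is bounded by the frame norm `Σ W²` (the private lemma of
`GurskyEinsteinGapProofs.lean`, repeated). [folklore] -/
private theorem weylFrame_sq_le_weylNormSqFrame' {M : Type*} [TopologicalSpace M]
    [ChartedSpace (EuclideanSpace ℝ (Fin 4)) M] [IsManifold (𝓡 4) ∞ M]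
    (g : PseudoRiemannianMetric (𝓡 4) ∞ (EuclideanSpace ℝ (Fin 4)) (TangentSpace (𝓡 4) : M → Type _))
    [g.HasLeviCivita] (x : M) (f : Fin 4 → TangentSpace (𝓡 4) x) (i j k l : Fin 4) :
    g.weylFrame x f i j k l ^ 2 ≤ g.weylNormSqFrame x f := by
  unfold weylNormSqFrame
  calc g.weylFrame x f i j k l ^ 2
      ≤ ∑ l', g.weylFrame x f i j k l' ^ 2 :=
        Finset.single_le_sum (f := fun l' ↦ g.weylFrame x f i j k l' ^ 2)
          (fun _ _ ↦ sq_nonneg _) (Finset.mem_univ l)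
    _ ≤ ∑ k', ∑ l', g.weylFrame x f i j k' l' ^ 2 :=
        Finset.single_le_sum (f := fun k' ↦ ∑ l', g.weylFrame x f i j k' l' ^ 2)
          (fun _ _ ↦ Finset.sum_nonneg fun _ _ ↦ sq_nonneg _) (Finset.mem_univ k)
    _ ≤ ∑ j', ∑ k', ∑ l', g.weylFrame x f i j' k' l' ^ 2 :=
        Finset.single_le_sum (f := fun j' ↦ ∑ k', ∑ l', g.weylFrame x f i j' k' l' ^ 2)
          (fun _ _ ↦ Finset.sum_nonneg fun _ _ ↦ Finset.sum_nonneg fun _ _ ↦ sq_nonneg _)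
          (Finset.mem_univ j)
    _ ≤ ∑ i', ∑ j', ∑ k', ∑ l', g.weylFrame x f i' j' k' l' ^ 2 :=
        Finset.single_le_sum (f := fun i' ↦ ∑ j', ∑ k', ∑ l', g.weylFrame x f i' j' k' l' ^ 2)
          (fun _ _ ↦ Finset.sum_nonneg fun _ _ ↦ Finset.sum_nonneg fun _ _ ↦
            Finset.sum_nonneg fun _ _ ↦ sq_nonneg _) (Finset.mem_univ i)

/-- **The oriented reduction of `gursky_einstein_homotopySphere_four` with THREE children** (Gursky–LeBrun
1999, §5, with the Chern–Gauss–Bonnet identity replaced by the proved inequality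
`∫⁻w₊ + ∫⁻w₋ + (2λ²/3) vol ≤ 16π²`): hypotheses `hThm1` (Thm. 1 for `w₊`), `hCor1` (Cor. 1 for `w₋`), `hSig`
(signature formula with `τ = 0`), exactly as in `gursky_einstein_homotopySphere_four_of_oriented`. Proof as
there: `M` simply connected, hence orientable; positive orthonormal frames exist and define `w^±`; if
`w⁺ ≢ 0`, `(2λ²/3) vol ≤ ∫⁻w₊ = ∫⁻w₋` and the inequality give `2λ² vol ≤ 16π²`; symmetrically for `w⁻`;
if both vanish identically, `Σ W(e)² = 4(w₊ + w₋) = 0` in the chosen frames, hence in every orthonormal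
frame, i.e. `W ≡ 0`. [cite: Gursky2000, Theorem 1] [cite: GurskyLebrun1999, §3 Thm. 1 and Cor. 1, §5] -/
theorem gursky_einstein_homotopySphere_four_of_oriented_three
    (hThm1 : GurskyLeBrun1999_thm1_homotopySphere) (hCor1 : GurskyLeBrun1999_cor1_homotopySphere)
    (hSig : signatureFormula_weyl_homotopySphere_four) :
    gursky_einstein_homotopySphere_four := by
  intro M _ _ _ _ _ _ _ _ _ hhe g _ hg lam hlam hRic
  have hE : finrank ℝ (EuclideanSpace ℝ (Fin 4)) = 4 := finrank_euclideanSpace_fin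
  have hn : (2 : ℕ∞ω) ≤ ((⊤ : ℕ∞) : ℕ∞ω) := WithTop.coe_le_coe.mpr le_top
  -- `M` is simply connected, hence orientable
  haveI : SimplyConnectedSpace (Metric.sphere (0 : EuclideanSpace ℝ (Fin (4 + 1))) 1) :=
    Literature.AlgebraicTopology.FundamentalGroup.simplyConnectedSpace_euclideanSphere 4 (by norm_num)
  haveI : SimplyConnectedSpace M := hhe.simplyConnectedSpace_iff.2 inferInstance
  obtain ⟨o⟩ := (isOrientable_of_simplyConnectedSpace_holds (I := 𝓡 4) (M := M) : IsOrientable (𝓡 4) M)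
  -- a positive orthonormal frame at every point, and the chiral Weyl norms read in it
  choose e he hpos using fun x ↦ exists_isOrthonormalFrame_isPosFrame (g := g) hg o x
  set wp : M → ℝ := fun x ↦ (1 / 4 : ℝ) * ∑ i : Fin 3, ∑ j : Fin 3,
    ((g.blockA g.leviCivita x (e x) -
      ((g.blockA g.leviCivita x (e x)).trace / 3) • (1 : Matrix (Fin 3) (Fin 3) ℝ)) i j) ^ 2 with hwp
  set wm : M → ℝ := fun x ↦ (1 / 4 : ℝ) * ∑ i : Fin 3, ∑ j : Fin 3,
    ((g.blockC g.leviCivita x (e x) -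
      ((g.blockC g.leviCivita x (e x)).trace / 3) • (1 : Matrix (Fin 3) (Fin 3) ℝ)) i j) ^ 2 with hwm
  have hP : ∀ x, ∃ f : Fin 4 → TangentSpace (𝓡 4) x, g.IsOrthonormalFrame x f ∧
      o.IsPosFrame x (frameOfFin f) ∧
      wp x = (1 / 4 : ℝ) * ∑ i : Fin 3, ∑ j : Fin 3,
        ((g.blockA g.leviCivita x f -
          ((g.blockA g.leviCivita x f).trace / 3) • (1 : Matrix (Fin 3) (Fin 3) ℝ)) i j) ^ 2 :=
    fun x ↦ ⟨e x, he x, hpos x, rfl⟩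
  have hMi : ∀ x, ∃ f : Fin 4 → TangentSpace (𝓡 4) x, g.IsOrthonormalFrame x f ∧
      o.IsPosFrame x (frameOfFin f) ∧
      wm x = (1 / 4 : ℝ) * ∑ i : Fin 3, ∑ j : Fin 3,
        ((g.blockC g.leviCivita x f -
          ((g.blockC g.leviCivita x f).trace / 3) • (1 : Matrix (Fin 3) (Fin 3) ℝ)) i j) ^ 2 :=
    fun x ↦ ⟨e x, he x, hpos x, rfl⟩
  have hPM : ∀ x, ∃ f : Fin 4 → TangentSpace (𝓡 4) x, g.IsOrthonormalFrame x f ∧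
      o.IsPosFrame x (frameOfFin f) ∧
      wp x = (1 / 4 : ℝ) * ∑ i : Fin 3, ∑ j : Fin 3,
        ((g.blockA g.leviCivita x f -
          ((g.blockA g.leviCivita x f).trace / 3) • (1 : Matrix (Fin 3) (Fin 3) ℝ)) i j) ^ 2 ∧
      wm x = (1 / 4 : ℝ) * ∑ i : Fin 3, ∑ j : Fin 3,
        ((g.blockC g.leviCivita x f -
          ((g.blockC g.leviCivita x f).trace / 3) • (1 : Matrix (Fin 3) (Fin 3) ℝ)) i j) ^ 2 :=
    fun x ↦ ⟨e x, he x, hpos x, rfl, rfl⟩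
  set μ := riemannianMeasure (g.toContMDiffRiemannianMetric hg) with hμ
  set V := μ Set.univ with hV
  -- pointwise: `w₊ + w₋ = ¼|W|²`, both nonnegative
  have hsum : ∀ x, wp x + wm x = (1 / 4 : ℝ) * g.weylNormSq x := fun x ↦ by
    rw [g.weylNormSq_eq_weylNormSqFrame_four hE (he x),
      weylNormSqFrame_eq_hamiltonBlocks g hn hE (he x)]
    simp only [hwp, hwm, Finset.sum_add_distrib]
    ring
  have hwp0 : ∀ x, 0 ≤ wp x := fun x ↦ by
    simp only [hwp]
    exact mul_nonneg (by norm_num) (Finset.sum_nonneg fun _ _ ↦ Finset.sum_nonneg fun _ _ ↦ sq_nonneg _)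
  have hwm0 : ∀ x, 0 ≤ wm x := fun x ↦ by
    simp only [hwm]
    exact mul_nonneg (by norm_num) (Finset.sum_nonneg fun _ _ ↦ Finset.sum_nonneg fun _ _ ↦ sq_nonneg _)
  -- the Chern–Gauss–Bonnet INEQUALITY for the lower integrals of the versions
  have hGB : ∫⁻ x, ENNReal.ofReal (wp x) ∂μ + ∫⁻ x, ENNReal.ofReal (wm x) ∂μ +
      ENNReal.ofReal (2 * lam ^ 2 / 3) * V ≤ ENNReal.ofReal (16 * Real.pi ^ 2) := by
    -- `∫⁻w₊ + ∫⁻w₋ ≤ ∫⁻(w₊ + w₋) = ¼ ∫|W|²`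
    have h1 : ∫⁻ x, ENNReal.ofReal (wp x) ∂μ + ∫⁻ x, ENNReal.ofReal (wm x) ∂μ ≤
        ENNReal.ofReal (1 / 4) * g.weylEnergy := by
      calc ∫⁻ x, ENNReal.ofReal (wp x) ∂μ + ∫⁻ x, ENNReal.ofReal (wm x) ∂μ
          ≤ ∫⁻ x, (ENNReal.ofReal (wp x) + ENNReal.ofReal (wm x)) ∂μ := le_lintegral_add _ _
        _ = ∫⁻ x, ENNReal.ofReal (1 / 4) * ENNReal.ofReal (g.weylNormSq x) ∂μ := by
            refine lintegral_congr fun x ↦ ?_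
            rw [← ENNReal.ofReal_add (hwp0 x) (hwm0 x), hsum x,
              ENNReal.ofReal_mul (by norm_num)]
        _ = ENNReal.ofReal (1 / 4) * ∫⁻ x, ENNReal.ofReal (g.weylNormSq x) ∂μ :=
            lintegral_const_mul' _ _ ENNReal.ofReal_ne_top
        _ = ENNReal.ofReal (1 / 4) * g.weylEnergy := by rw [g.weylEnergy_eq hg]
    -- `¼ ∫|W|² + (2λ²/3) V = 16π²` from the proved Chern–Gauss–Bonnet identity
    have h2 := weylEnergy_add_volume_eq_of_einstein_homotopySphere_four M hhe g hg lam hlam hRic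
    have h3 : ENNReal.ofReal (1 / 4) * g.weylEnergy + ENNReal.ofReal (2 * lam ^ 2 / 3) * V =
        ENNReal.ofReal (16 * Real.pi ^ 2) := by
      have h4 : ENNReal.ofReal (1 / 4) * (g.weylEnergy + ENNReal.ofReal (8 * lam ^ 2 / 3) * V) =
          ENNReal.ofReal (1 / 4) * ENNReal.ofReal (64 * Real.pi ^ 2) := by rw [h2]
      rw [mul_add, ← mul_assoc, ← ENNReal.ofReal_mul (by norm_num),
        ← ENNReal.ofReal_mul (by norm_num),
        show (1 / 4 : ℝ) * (8 * lam ^ 2 / 3) = 2 * lam ^ 2 / 3 by ring,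
        show (1 / 4 : ℝ) * (64 * Real.pi ^ 2) = 16 * Real.pi ^ 2 by ring] at h4
      exact h4
    calc ∫⁻ x, ENNReal.ofReal (wp x) ∂μ + ∫⁻ x, ENNReal.ofReal (wm x) ∂μ +
          ENNReal.ofReal (2 * lam ^ 2 / 3) * V
        ≤ ENNReal.ofReal (1 / 4) * g.weylEnergy + ENNReal.ofReal (2 * lam ^ 2 / 3) * V := by
          gcongr
      _ = ENNReal.ofReal (16 * Real.pi ^ 2) := h3
  -- the volume conclusion from `(2λ²/3) V ≤ P`, `P = N` and the inequality
  have volume_le : ∀ {P N : ℝ≥0∞}, ENNReal.ofReal (2 * lam ^ 2 / 3) * V ≤ P → P = N →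
      P + N + ENNReal.ofReal (2 * lam ^ 2 / 3) * V ≤ ENNReal.ofReal (16 * Real.pi ^ 2) →
      V ≤ ENNReal.ofReal (8 * Real.pi ^ 2 / lam ^ 2) := by
    intro P N h1 h2 h3
    have h4 : ENNReal.ofReal (2 * lam ^ 2 / 3) * V + ENNReal.ofReal (2 * lam ^ 2 / 3) * V +
        ENNReal.ofReal (2 * lam ^ 2 / 3) * V ≤ ENNReal.ofReal (16 * Real.pi ^ 2) := by
      calc _ ≤ P + N + ENNReal.ofReal (2 * lam ^ 2 / 3) * V :=
            add_le_add (add_le_add h1 (h2 ▸ h1)) le_rfl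
        _ ≤ _ := h3
    rw [← add_mul, ← add_mul, ← ENNReal.ofReal_add (by positivity) (by positivity),
      ← ENNReal.ofReal_add (by positivity) (by positivity),
      show 2 * lam ^ 2 / 3 + 2 * lam ^ 2 / 3 + 2 * lam ^ 2 / 3 = 2 * lam ^ 2 by ring] at h4
    have hpos2 : 0 < 2 * lam ^ 2 := by positivity
    calc V ≤ ENNReal.ofReal (16 * Real.pi ^ 2) / ENNReal.ofReal (2 * lam ^ 2) := by
          rw [ENNReal.le_div_iff_mul_le (Or.inl (ENNReal.ofReal_pos.2 hpos2).ne')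
            (Or.inl ENNReal.ofReal_ne_top), mul_comm]
          exact h4
      _ = ENNReal.ofReal (16 * Real.pi ^ 2 / (2 * lam ^ 2)) := (ENNReal.ofReal_div_of_pos hpos2).symm
      _ = ENNReal.ofReal (8 * Real.pi ^ 2 / lam ^ 2) := by
          congr 1
          field_simp
          ring
  by_cases h0 : (∀ x, wp x = 0) ∧ (∀ x, wm x = 0)
  · -- `W⁺ ≡ 0` and `W⁻ ≡ 0` in the chosen positive frames: `W ≡ 0` in every orthonormal frame
    left
    intro x f hf i j k l
    have hex : g.weylNormSqFrame x (e x) = 0 := by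
      have h := hsum x
      rw [h0.1 x, h0.2 x, g.weylNormSq_eq_weylNormSqFrame_four hE (he x)] at h
      linarith
    have hfx : g.weylNormSqFrame x f = 0 := by
      rw [g.weylNormSqFrame_eq_of_isOrthonormalFrame hf (by simp) (he x) (by simp), hex]
    have hsq := weylFrame_sq_le_weylNormSqFrame' g x f i j k l
    rw [hfx] at hsq
    exact pow_eq_zero_iff (n := 2) (by norm_num) |>.1 (le_antisymm hsq (sq_nonneg _))
  · right
    rcases not_and_or.1 h0 with h1 | h1
    · push Not at h1
      exact volume_le (hThm1 M hhe g hg lam hlam hRic o wp hP h1)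
        (hSig M hhe g hg lam hlam hRic o wp wm hPM) hGB
    · push Not at h1
      have h2 := hSig M hhe g hg lam hlam hRic o wp wm hPM
      have h3 := hGB
      rw [add_comm (∫⁻ x, ENNReal.ofReal (wp x) ∂_)] at h3
      exact volume_le (hCor1 M hhe g hg lam hlam hRic o wm hMi h1) h2.symm h3

/-- **Gursky's gap from the three printed children** — Gursky–LeBrun 1999 Thm. 1, Cor. 1 and the
signature formula with `τ(M ≃ₕ S⁴) = 0` (the named children `GurskyLeBrun1999_thm1_homotopySphere`,
`GurskyLeBrun1999_cor1_homotopySphere`, `signatureFormula_weyl_homotopySphere_four` of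
`GurskyEinsteinGapSplit.lean`); the fourth child `chernGaussBonnet_einstein_homotopySphere_four` of
`gursky_einstein_homotopySphere_four_holds_of` is no longer an input. [cite: Gursky2000, Theorem 1]
[cite: GurskyLebrun1999, §5] -/
theorem gursky_einstein_homotopySphere_four_holds_of_three
    (h₁ : GurskyLeBrun1999_thm1_homotopySphere) (h₂ : GurskyLeBrun1999_cor1_homotopySphere)
    (h₃ : signatureFormula_weyl_homotopySphere_four) :
    gursky_einstein_homotopySphere_four :=
  gursky_einstein_homotopySphere_four_of_oriented_three h₁ h₂ h₃

end Literature.Geometry.Riemannian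

end
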